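import Literature.Topology.FourManifolds.TautFoliationsContourSquareFloor
import HarnessLib

/-!
# Radial squares: contour lines of a cone over boundary heights depending on the distance to a far point

Sibling of `TautFoliationsContourSquare.lean` / `TautFoliationsConeCorners.lean`. In the collar
of a coned disc whose map is a fence read in square-polar coordinates, the boundary heights of
a small square `Q = closedBall c_Q ℓ` are `ψ = Ψ ∘ dist(·, c₀)` with `Ψ` strictly monotone:
they depend only on the (sup-metric) distance to the far centre `c₀` of the big square. We
describe the contour lines of the cone over such **radial** boundary heights:

* `isPreconnected_sphere_inter_closedBall` (**proved**): for `ℓ < R`, the part of the boundary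
  square `sphere c_Q ℓ` inside the big square `closedBall c₀ R` is preconnected (it is a union
  of consecutive sides of a rectangle sharing a corner with `Q`); likewise for the complement of
  the open big square (`isPreconnected_sphere_diff_ball`).
* `levelLine` (**definition**), `levelLine_eq_image(_floor)`, `isPreconnected_levelLine(_floor)`,
  `isCompact_levelLine(_floor)`, `levelLine_inter_sphere` (**proved**): the contour line
  `{coneHt = h}` is the `levelPt`-image of the sub/super-level boundary arc.
* `IsRadial` (**definition**), `IsRadial.isPreconnected_arcs`, `IsRadial.isPreconnected_levelLine(_floor)`,
  `IsRadial.levelLine_inter_sphere` (**proved**): for radial boundary heights the contour line at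
  the height of the radius `R` is connected and meets the boundary square exactly on `sphere c₀ R`.

All statements are [folklore].
-/

noncomputable section

open Set Filter Metric Topology Function

namespace Literature.Topology.FourManifolds

namespace ConeSquare

/-! ## A union lemma for preconnected sets -/

/-- **Cross unions are preconnected**: the union of two families of preconnected sets such that
every nonempty member of the first meets every nonempty member of the second, both families
having a nonempty member, is preconnected. [folklore] -/
theorem isPreconnected_iUnion_union_iUnion {X : Type*} [TopologicalSpace X] {ι κ : Type*} {V : ι → Set X} {H : κ → Set X}
    (hV : ∀ i, IsPreconnected (V i)) (hH : ∀ j, IsPreconnected (H j))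
    (hcross : ∀ i j, (V i).Nonempty → (H j).Nonempty → (V i ∩ H j).Nonempty)
    {i₀ : ι} (hi₀ : (V i₀).Nonempty) {j₀ : κ} (hj₀ : (H j₀).Nonempty) :
    IsPreconnected ((⋃ i, V i) ∪ ⋃ j, H j) := by
  obtain ⟨x₀, hx₀⟩ := hj₀
  -- `T = H j₀ ∪ ⋃ V i` is preconnected
  set T : Set X := ⋃ i, (H j₀ ∪ V i) with hT
  have hTpre : IsPreconnected T := by
    refine isPreconnected_iUnion ⟨x₀, mem_iInter.2 fun i ↦ Or.inl hx₀⟩ fun i ↦ ?_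
    by_cases hi : (V i).Nonempty
    · obtain ⟨y, hy⟩ := hcross i j₀ hi ⟨x₀, hx₀⟩
      exact (hH j₀).union y hy.2 hy.1 (hV i)
    · rw [not_nonempty_iff_eq_empty.1 hi, union_empty]
      exact hH j₀
  have hx₀T : x₀ ∈ T := mem_iUnion.2 ⟨i₀, Or.inl hx₀⟩
  have hVT : V i₀ ⊆ T := fun y hy ↦ mem_iUnion.2 ⟨i₀, Or.inr hy⟩
  -- the whole union is `⋃ j, (T ∪ H j)`
  have heq : ((⋃ i, V i) ∪ ⋃ j, H j) = ⋃ j, (T ∪ H j) := by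
    ext y
    simp only [mem_union, mem_iUnion, hT]
    constructor
    · rintro (⟨i, hy⟩ | ⟨j, hy⟩)
      · exact ⟨j₀, Or.inl ⟨i, Or.inr hy⟩⟩
      · exact ⟨j, Or.inr hy⟩
    · rintro ⟨j, ⟨i, hy | hy⟩ | hy⟩
      · exact Or.inr ⟨j₀, hy⟩
      · exact Or.inl ⟨i, hy⟩
      · exact Or.inr ⟨j, hy⟩
  rw [heq]
  refine isPreconnected_iUnion ⟨x₀, mem_iInter.2 fun j ↦ Or.inl hx₀T⟩ fun j ↦ ?_
  by_cases hj : (H j).Nonempty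
  · obtain ⟨y, hy⟩ := hcross i₀ j hi₀ hj
    exact hTpre.union y (hVT hy.1) hy.2 (hH j)
  · rw [not_nonempty_iff_eq_empty.1 hj, union_empty]
    exact hTpre

/-! ## The boundary square cut by a big square -/

variable {c₀ c : ℝ × ℝ} {ℓ R : ℝ}

/-- Membership in the boundary square in coordinates. [folklore] -/
theorem mem_sphere_iff_coord {x : ℝ × ℝ} : x ∈ sphere c ℓ ↔
    (|x.1 - c.1| = ℓ ∧ |x.2 - c.2| ≤ ℓ) ∨ (|x.2 - c.2| = ℓ ∧ |x.1 - c.1| ≤ ℓ) := by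
  rw [mem_sphere, Prod.dist_eq, Real.dist_eq, Real.dist_eq]
  constructor
  · intro h
    rcases le_total |x.1 - c.1| |x.2 - c.2| with h' | h'
    · rw [max_eq_right h'] at h; exact Or.inr ⟨h, h ▸ h'⟩
    · rw [max_eq_left h'] at h; exact Or.inl ⟨h, h ▸ h'⟩
  · rintro (⟨h1, h2⟩ | ⟨h1, h2⟩)
    · rw [max_eq_left (h1 ▸ h2), h1]
    · rw [max_eq_right (h1 ▸ h2), h1]

/-- Membership in the big closed square in coordinates. [folklore] -/
theorem mem_closedBall_iff_coord {x : ℝ × ℝ} : x ∈ closedBall c₀ R ↔ |x.1 - c₀.1| ≤ R ∧ |x.2 - c₀.2| ≤ R := by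
  rw [mem_closedBall, Prod.dist_eq, Real.dist_eq, Real.dist_eq, max_le_iff]

/-- **The part of a boundary square inside a bigger closed square is preconnected.**
[folklore] -/
theorem isPreconnected_sphere_inter_closedBall (hℓ : 0 < ℓ) (hR : ℓ < R) :
    IsPreconnected (sphere c ℓ ∩ closedBall c₀ R) := by
  -- the coordinate intervals of the cut rectangle
  set J₁ : Set ℝ := {t | |t - c.1| ≤ ℓ ∧ |t - c₀.1| ≤ R} with hJ₁
  set J₂ : Set ℝ := {t | |t - c.2| ≤ ℓ ∧ |t - c₀.2| ≤ R} with hJ₂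
  have hJ₁c : IsPreconnected J₁ := by
    have : J₁ = Icc (c.1 - ℓ) (c.1 + ℓ) ∩ Icc (c₀.1 - R) (c₀.1 + R) := by
      ext t; simp only [hJ₁, mem_setOf_eq, mem_inter_iff, mem_Icc, abs_le]; constructor <;> intro h <;>
        refine ⟨⟨?_, ?_⟩, ?_, ?_⟩ <;> linarith [h.1.1, h.1.2, h.2.1, h.2.2]
    rw [this, Icc_inter_Icc]; exact isPreconnected_Icc
  have hJ₂c : IsPreconnected J₂ := by
    have : J₂ = Icc (c.2 - ℓ) (c.2 + ℓ) ∩ Icc (c₀.2 - R) (c₀.2 + R) := by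
      ext t; simp only [hJ₂, mem_setOf_eq, mem_inter_iff, mem_Icc, abs_le]; constructor <;> intro h <;>
        refine ⟨⟨?_, ?_⟩, ?_, ?_⟩ <;> linarith [h.1.1, h.1.2, h.2.1, h.2.2]
    rw [this, Icc_inter_Icc]; exact isPreconnected_Icc
  -- each nonempty interval contains an end of the side range (as `ℓ < R`)
  have hend₁ : J₁.Nonempty → (c.1 - ℓ) ∈ J₁ ∨ (c.1 + ℓ) ∈ J₁ := by
    rintro ⟨t, ht₁, ht₂⟩
    rw [abs_le] at ht₁ ht₂
    by_cases h : |c.1 - ℓ - c₀.1| ≤ R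
    · exact Or.inl ⟨by rw [show c.1 - ℓ - c.1 = -ℓ by ring, abs_neg, abs_of_pos hℓ], h⟩
    · refine Or.inr ⟨by rw [show c.1 + ℓ - c.1 = ℓ by ring, abs_of_pos hℓ], ?_⟩
      rw [abs_le]; rw [abs_le, not_and_or, not_le, not_le] at h
      rcases h with h | h <;> constructor <;> linarith
  have hend₂ : J₂.Nonempty → (c.2 - ℓ) ∈ J₂ ∨ (c.2 + ℓ) ∈ J₂ := by
    rintro ⟨t, ht₁, ht₂⟩
    rw [abs_le] at ht₁ ht₂
    by_cases h : |c.2 - ℓ - c₀.2| ≤ R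
    · exact Or.inl ⟨by rw [show c.2 - ℓ - c.2 = -ℓ by ring, abs_neg, abs_of_pos hℓ], h⟩
    · refine Or.inr ⟨by rw [show c.2 + ℓ - c.2 = ℓ by ring, abs_of_pos hℓ], ?_⟩
      rw [abs_le]; rw [abs_le, not_and_or, not_le, not_le] at h
      rcases h with h | h <;> constructor <;> linarith
  -- the vertical and horizontal sides of the cut rectangle lying on the boundary square
  set a : Bool → ℝ := fun b ↦ if b then c.1 + ℓ else c.1 - ℓ with ha
  set b₂ : Bool → ℝ := fun b ↦ if b then c.2 + ℓ else c.2 - ℓ with hb₂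
  set V : Bool → Set (ℝ × ℝ) := fun i ↦ {x | x.1 = a i ∧ a i ∈ J₁ ∧ x.2 ∈ J₂} with hV
  set H : Bool → Set (ℝ × ℝ) := fun j ↦ {x | x.2 = b₂ j ∧ b₂ j ∈ J₂ ∧ x.1 ∈ J₁} with hH
  have haℓ : ∀ i, |a i - c.1| = ℓ := fun i ↦ by
    cases i <;> simp only [ha, if_true, if_false, Bool.false_eq_true]
    · rw [show c.1 - ℓ - c.1 = -ℓ by ring, abs_neg, abs_of_pos hℓ]
    · rw [show c.1 + ℓ - c.1 = ℓ by ring, abs_of_pos hℓ]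
  have hbℓ : ∀ j, |b₂ j - c.2| = ℓ := fun j ↦ by
    cases j <;> simp only [hb₂, if_true, if_false, Bool.false_eq_true]
    · rw [show c.2 - ℓ - c.2 = -ℓ by ring, abs_neg, abs_of_pos hℓ]
    · rw [show c.2 + ℓ - c.2 = ℓ by ring, abs_of_pos hℓ]
  -- the set is the cross union
  have heq : sphere c ℓ ∩ closedBall c₀ R = (⋃ i, V i) ∪ ⋃ j, H j := by
    ext x
    rw [mem_inter_iff, mem_sphere_iff_coord, mem_closedBall_iff_coord]
    simp only [mem_union, mem_iUnion, hV, hH, mem_setOf_eq]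
    constructor
    · rintro ⟨(⟨h1, h2⟩ | ⟨h1, h2⟩), hb1, hb2⟩
      · -- on a vertical side
        left
        have hx1 : x.1 = c.1 - ℓ ∨ x.1 = c.1 + ℓ := by
          rcases abs_eq (hℓ.le) |>.1 h1 with h | h
          · exact Or.inr (by linarith)
          · exact Or.inl (by linarith)
        rcases hx1 with h | h
        · refine ⟨false, ?_, ?_, h2, hb2⟩
          · simp [ha, h]
          · simp only [ha, Bool.false_eq_true, if_false]; exact ⟨by rw [← h]; exact h1.le, by rw [← h]; exact hb1⟩
        · refine ⟨true, ?_, ?_, h2, hb2⟩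
          · simp [ha, h]
          · simp only [ha, if_true]; exact ⟨by rw [← h]; exact h1.le, by rw [← h]; exact hb1⟩
      · right
        have hx2 : x.2 = c.2 - ℓ ∨ x.2 = c.2 + ℓ := by
          rcases abs_eq (hℓ.le) |>.1 h1 with h | h
          · exact Or.inr (by linarith)
          · exact Or.inl (by linarith)
        rcases hx2 with h | h
        · refine ⟨false, ?_, ?_, h2, hb1⟩
          · simp [hb₂, h]
          · simp only [hb₂, Bool.false_eq_true, if_false]; exact ⟨by rw [← h]; exact h1.le, by rw [← h]; exact hb2⟩
        · refine ⟨true, ?_, ?_, h2, hb1⟩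
          · simp [hb₂, h]
          · simp only [hb₂, if_true]; exact ⟨by rw [← h]; exact h1.le, by rw [← h]; exact hb2⟩
    · rintro (⟨i, hx1, ⟨-, hai⟩, hx2, hx2'⟩ | ⟨j, hx2, ⟨-, hbj⟩, hx1, hx1'⟩)
      · exact ⟨Or.inl ⟨by rw [hx1]; exact haℓ i, hx2⟩, by rw [hx1]; exact hai, hx2'⟩
      · exact ⟨Or.inr ⟨by rw [hx2]; exact hbℓ j, hx1⟩, hx1', by rw [hx2]; exact hbj⟩
  rw [heq]
  -- trivial case: empty
  by_cases hne : (sphere c ℓ ∩ closedBall c₀ R).Nonempty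
  swap
  · rw [← heq, not_nonempty_iff_eq_empty.1 hne]; exact isPreconnected_empty
  -- the intervals are nonempty
  obtain ⟨x, hx⟩ := hne
  have hx' := hx
  rw [mem_inter_iff, mem_sphere_iff_coord, mem_closedBall_iff_coord] at hx'
  have hJ₁ne : J₁.Nonempty := ⟨x.1, by rcases hx'.1 with h | h <;> [exact ⟨h.1.le, hx'.2.1⟩; exact ⟨h.2, hx'.2.1⟩]⟩
  have hJ₂ne : J₂.Nonempty := ⟨x.2, by rcases hx'.1 with h | h <;> [exact ⟨h.2, hx'.2.2⟩; exact ⟨h.1.le, hx'.2.2⟩]⟩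
  -- nonempty members
  obtain ⟨i₀, hi₀⟩ : ∃ i, (V i).Nonempty := by
    obtain ⟨t, ht⟩ := hJ₂ne
    rcases hend₁ hJ₁ne with h | h
    · exact ⟨false, ⟨(c.1 - ℓ, t), rfl, by simpa [ha] using h, ht⟩⟩
    · exact ⟨true, ⟨(c.1 + ℓ, t), rfl, by simpa [ha] using h, ht⟩⟩
  obtain ⟨j₀, hj₀⟩ : ∃ j, (H j).Nonempty := by
    obtain ⟨t, ht⟩ := hJ₁ne
    rcases hend₂ hJ₂ne with h | h
    · exact ⟨false, ⟨(t, c.2 - ℓ), rfl, by simpa [hb₂] using h, ht⟩⟩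
    · exact ⟨true, ⟨(t, c.2 + ℓ), rfl, by simpa [hb₂] using h, ht⟩⟩
  refine isPreconnected_iUnion_union_iUnion (fun i ↦ ?_) (fun j ↦ ?_) (fun i j hi hj ↦ ?_) hi₀ hj₀
  · -- vertical sides are preconnected
    by_cases hai : a i ∈ J₁
    · have : V i = (fun t ↦ (a i, t)) '' J₂ := by
        ext y; simp only [hV, mem_setOf_eq, mem_image]; constructor
        · rintro ⟨h1, -, h2⟩; exact ⟨y.2, h2, by rw [← h1]⟩
        · rintro ⟨t, ht, rfl⟩; exact ⟨rfl, hai, ht⟩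
      rw [this]; exact hJ₂c.image _ (by fun_prop : Continuous fun t : ℝ ↦ (a i, t)).continuousOn
    · have : V i = ∅ := eq_empty_of_forall_notMem fun y hy ↦ hai hy.2.1
      rw [this]; exact isPreconnected_empty
  · by_cases hbj : b₂ j ∈ J₂
    · have : H j = (fun t ↦ (t, b₂ j)) '' J₁ := by
        ext y; simp only [hH, mem_setOf_eq, mem_image]; constructor
        · rintro ⟨h1, -, h2⟩; exact ⟨y.1, h2, by rw [← h1]⟩
        · rintro ⟨t, ht, rfl⟩; exact ⟨rfl, hbj, ht⟩
      rw [this]; exact hJ₁c.image _ (by fun_prop : Continuous fun t : ℝ ↦ (t, b₂ j)).continuousOn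
    · have : H j = ∅ := eq_empty_of_forall_notMem fun y hy ↦ hbj hy.2.1
      rw [this]; exact isPreconnected_empty
  · -- crossing: the corner `(a i, b j)`
    obtain ⟨y, -, hai, -⟩ := hi
    obtain ⟨z, -, hbj, -⟩ := hj
    exact ⟨(a i, b₂ j), ⟨rfl, hai, hbj⟩, ⟨rfl, hbj, hai⟩⟩

/-- A half-plane piece of the boundary square is a big-square piece, hence preconnected:
`{x ∈ sphere c ℓ | A ≤ x.1}`. [folklore] -/
theorem isPreconnected_sphere_inter_fst_ge (hℓ : 0 < ℓ) (A : ℝ) : IsPreconnected (sphere c ℓ ∩ {x | A ≤ x.1}) := by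
  set N : ℝ := ℓ + |c.1 + ℓ - A| + 1 with hN
  have hNℓ : ℓ < N := by have := abs_nonneg (c.1 + ℓ - A); linarith
  have heq : sphere c ℓ ∩ {x | A ≤ x.1} = sphere c ℓ ∩ closedBall ((A + N, c.2) : ℝ × ℝ) N := by
    ext x
    simp only [mem_inter_iff, mem_setOf_eq, mem_closedBall_iff_coord]
    constructor
    · rintro ⟨hs, hA⟩
      have h1 : |x.1 - c.1| ≤ ℓ ∧ |x.2 - c.2| ≤ ℓ := by
        have := hs; rw [mem_sphere, Prod.dist_eq, Real.dist_eq, Real.dist_eq] at this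
        exact ⟨le_of_max_le_left this.le, le_of_max_le_right this.le⟩
      refine ⟨hs, abs_le.2 ⟨by linarith, ?_⟩, h1.2.trans hNℓ.le⟩
      have := abs_le.1 h1.1
      have := le_abs_self (c.1 + ℓ - A)
      linarith
    · rintro ⟨hs, h1, -⟩
      exact ⟨hs, by linarith [(abs_le.1 h1).1]⟩
  rw [heq]
  exact isPreconnected_sphere_inter_closedBall hℓ hNℓ

/-- `{x ∈ sphere c ℓ | x.1 ≤ A}` is preconnected. [folklore] -/
theorem isPreconnected_sphere_inter_fst_le (hℓ : 0 < ℓ) (A : ℝ) : IsPreconnected (sphere c ℓ ∩ {x | x.1 ≤ A}) := by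
  set N : ℝ := ℓ + |c.1 - ℓ - A| + 1 with hN
  have hNℓ : ℓ < N := by have := abs_nonneg (c.1 - ℓ - A); linarith
  have heq : sphere c ℓ ∩ {x | x.1 ≤ A} = sphere c ℓ ∩ closedBall ((A - N, c.2) : ℝ × ℝ) N := by
    ext x
    simp only [mem_inter_iff, mem_setOf_eq, mem_closedBall_iff_coord]
    constructor
    · rintro ⟨hs, hA⟩
      have h1 : |x.1 - c.1| ≤ ℓ ∧ |x.2 - c.2| ≤ ℓ := by
        have := hs; rw [mem_sphere, Prod.dist_eq, Real.dist_eq, Real.dist_eq] at this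
        exact ⟨le_of_max_le_left this.le, le_of_max_le_right this.le⟩
      refine ⟨hs, abs_le.2 ⟨?_, by linarith⟩, h1.2.trans hNℓ.le⟩
      have := abs_le.1 h1.1
      have := neg_abs_le (c.1 - ℓ - A)
      linarith
    · rintro ⟨hs, h1, -⟩
      exact ⟨hs, by linarith [(abs_le.1 h1).2]⟩
  rw [heq]
  exact isPreconnected_sphere_inter_closedBall hℓ hNℓ

/-- `{x ∈ sphere c ℓ | A ≤ x.2}` is preconnected. [folklore] -/
theorem isPreconnected_sphere_inter_snd_ge (hℓ : 0 < ℓ) (A : ℝ) : IsPreconnected (sphere c ℓ ∩ {x | A ≤ x.2}) := by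
  set N : ℝ := ℓ + |c.2 + ℓ - A| + 1 with hN
  have hNℓ : ℓ < N := by have := abs_nonneg (c.2 + ℓ - A); linarith
  have heq : sphere c ℓ ∩ {x | A ≤ x.2} = sphere c ℓ ∩ closedBall ((c.1, A + N) : ℝ × ℝ) N := by
    ext x
    simp only [mem_inter_iff, mem_setOf_eq, mem_closedBall_iff_coord]
    constructor
    · rintro ⟨hs, hA⟩
      have h1 : |x.1 - c.1| ≤ ℓ ∧ |x.2 - c.2| ≤ ℓ := by
        have := hs; rw [mem_sphere, Prod.dist_eq, Real.dist_eq, Real.dist_eq] at this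
        exact ⟨le_of_max_le_left this.le, le_of_max_le_right this.le⟩
      refine ⟨hs, h1.1.trans hNℓ.le, abs_le.2 ⟨by linarith, ?_⟩⟩
      have := abs_le.1 h1.2
      have := le_abs_self (c.2 + ℓ - A)
      linarith
    · rintro ⟨hs, -, h1⟩
      exact ⟨hs, by linarith [(abs_le.1 h1).1]⟩
  rw [heq]
  exact isPreconnected_sphere_inter_closedBall hℓ hNℓ

/-- `{x ∈ sphere c ℓ | x.2 ≤ A}` is preconnected. [folklore] -/
theorem isPreconnected_sphere_inter_snd_le (hℓ : 0 < ℓ) (A : ℝ) : IsPreconnected (sphere c ℓ ∩ {x | x.2 ≤ A}) := by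
  set N : ℝ := ℓ + |c.2 - ℓ - A| + 1 with hN
  have hNℓ : ℓ < N := by have := abs_nonneg (c.2 - ℓ - A); linarith
  have heq : sphere c ℓ ∩ {x | x.2 ≤ A} = sphere c ℓ ∩ closedBall ((c.1, A - N) : ℝ × ℝ) N := by
    ext x
    simp only [mem_inter_iff, mem_setOf_eq, mem_closedBall_iff_coord]
    constructor
    · rintro ⟨hs, hA⟩
      have h1 : |x.1 - c.1| ≤ ℓ ∧ |x.2 - c.2| ≤ ℓ := by
        have := hs; rw [mem_sphere, Prod.dist_eq, Real.dist_eq, Real.dist_eq] at this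
        exact ⟨le_of_max_le_left this.le, le_of_max_le_right this.le⟩
      refine ⟨hs, h1.1.trans hNℓ.le, abs_le.2 ⟨?_, by linarith⟩⟩
      have := abs_le.1 h1.2
      have := neg_abs_le (c.2 - ℓ - A)
      linarith
    · rintro ⟨hs, -, h1⟩
      exact ⟨hs, by linarith [(abs_le.1 h1).2]⟩
  rw [heq]
  exact isPreconnected_sphere_inter_closedBall hℓ hNℓ

/-- **The part of a boundary square outside a bigger open square is preconnected** (for a
square of half-side `ℓ < R`). [folklore] -/
theorem isPreconnected_sphere_diff_ball (hℓ : 0 < ℓ) (hR : ℓ < R) :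
    IsPreconnected (sphere c ℓ ∩ (ball c₀ R)ᶜ) := by
  have hbd : ∀ x ∈ sphere c ℓ, |x.1 - c.1| ≤ ℓ ∧ |x.2 - c.2| ≤ ℓ := fun x hs ↦ by
    rw [mem_sphere, Prod.dist_eq, Real.dist_eq, Real.dist_eq] at hs
    exact ⟨le_of_max_le_left hs.le, le_of_max_le_right hs.le⟩
  -- the four pieces
  set V : Bool → Set (ℝ × ℝ) := fun i ↦ if i then sphere c ℓ ∩ {x | c₀.1 + R ≤ x.1} else sphere c ℓ ∩ {x | x.1 ≤ c₀.1 - R}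
    with hV
  set H : Bool → Set (ℝ × ℝ) := fun j ↦ if j then sphere c ℓ ∩ {x | c₀.2 + R ≤ x.2} else sphere c ℓ ∩ {x | x.2 ≤ c₀.2 - R}
    with hH
  have hVpre : ∀ i, IsPreconnected (V i) := fun i ↦ by
    cases i
    · exact isPreconnected_sphere_inter_fst_le hℓ _
    · exact isPreconnected_sphere_inter_fst_ge hℓ _
  have hHpre : ∀ j, IsPreconnected (H j) := fun j ↦ by
    cases j
    · exact isPreconnected_sphere_inter_snd_le hℓ _
    · exact isPreconnected_sphere_inter_snd_ge hℓ _
  have heq : sphere c ℓ ∩ (ball c₀ R)ᶜ = (⋃ i, V i) ∪ ⋃ j, H j := by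
    ext x
    simp only [mem_inter_iff, mem_compl_iff, mem_ball, Prod.dist_eq, Real.dist_eq, max_lt_iff, not_and_or, not_lt,
      mem_union, mem_iUnion, hV, hH]
    constructor
    · rintro ⟨hs, h | h⟩
      · left
        rcases le_abs'.1 h with h' | h'
        · exact ⟨false, by simp only [Bool.false_eq_true, if_false]; exact ⟨hs, by show x.1 ≤ c₀.1 - R; linarith⟩⟩
        · exact ⟨true, by simp only [if_true]; exact ⟨hs, by show c₀.1 + R ≤ x.1; linarith⟩⟩
      · right
        rcases le_abs'.1 h with h' | h'
        · exact ⟨false, by simp only [Bool.false_eq_true, if_false]; exact ⟨hs, by show x.2 ≤ c₀.2 - R; linarith⟩⟩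
        · exact ⟨true, by simp only [if_true]; exact ⟨hs, by show c₀.2 + R ≤ x.2; linarith⟩⟩
    · rintro (⟨i, h⟩ | ⟨j, h⟩)
      · cases i
        · simp only [Bool.false_eq_true, if_false] at h
          exact ⟨h.1, Or.inl (le_abs.2 (Or.inr (by have : x.1 ≤ c₀.1 - R := h.2; linarith)))⟩
        · simp only [if_true] at h
          exact ⟨h.1, Or.inl (le_abs.2 (Or.inl (by have : c₀.1 + R ≤ x.1 := h.2; linarith)))⟩
      · cases j
        · simp only [Bool.false_eq_true, if_false] at h
          exact ⟨h.1, Or.inr (le_abs.2 (Or.inr (by have : x.2 ≤ c₀.2 - R := h.2; linarith)))⟩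
        · simp only [if_true] at h
          exact ⟨h.1, Or.inr (le_abs.2 (Or.inl (by have : c₀.2 + R ≤ x.2 := h.2; linarith)))⟩
  rw [heq]
  -- the corner of the square in the directions of nonempty pieces lies in both
  have hcorner : ∀ i j, (V i).Nonempty → (H j).Nonempty → (V i ∩ H j).Nonempty := by
    intro i j ⟨x, hx⟩ ⟨y, hy⟩
    set v : ℝ × ℝ := (if i then c.1 + ℓ else c.1 - ℓ, if j then c.2 + ℓ else c.2 - ℓ) with hv
    have hvs : v ∈ sphere c ℓ := by
      rw [mem_sphere_iff_coord]
      left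
      constructor
      · cases i <;> simp [hv, abs_of_pos hℓ]
      · cases j <;> simp [hv, abs_of_pos hℓ]
    refine ⟨v, ?_, ?_⟩
    · cases i
      · simp only [hV, Bool.false_eq_true, if_false] at hx ⊢
        refine ⟨hvs, ?_⟩
        show c.1 - ℓ ≤ c₀.1 - R
        have h1 := (abs_le.1 (hbd x hx.1).1).1; have h2 : x.1 ≤ c₀.1 - R := hx.2; linarith
      · simp only [hV, if_true] at hx ⊢
        refine ⟨hvs, ?_⟩
        show c₀.1 + R ≤ c.1 + ℓ
        have h1 := (abs_le.1 (hbd x hx.1).1).2; have h2 : c₀.1 + R ≤ x.1 := hx.2; linarith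
    · cases j
      · simp only [hH, Bool.false_eq_true, if_false] at hy ⊢
        refine ⟨hvs, ?_⟩
        show c.2 - ℓ ≤ c₀.2 - R
        have h1 := (abs_le.1 (hbd y hy.1).2).1; have h2 : y.2 ≤ c₀.2 - R := hy.2; linarith
      · simp only [hH, if_true] at hy ⊢
        refine ⟨hvs, ?_⟩
        show c₀.2 + R ≤ c.2 + ℓ
        have h1 := (abs_le.1 (hbd y hy.1).2).2; have h2 : c₀.2 + R ≤ y.2 := hy.2; linarith
  -- opposite pieces are not both nonempty
  have hoppV : ¬ ((V false).Nonempty ∧ (V true).Nonempty) := by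
    rintro ⟨⟨x, hx⟩, ⟨y, hy⟩⟩
    simp only [hV, Bool.false_eq_true, if_false, if_true] at hx hy
    have h1 := (abs_le.1 (hbd x hx.1).1).1; have h2 := (abs_le.1 (hbd y hy.1).1).2
    have h3 : x.1 ≤ c₀.1 - R := hx.2; have h4 : c₀.1 + R ≤ y.1 := hy.2
    linarith
  have hoppH : ¬ ((H false).Nonempty ∧ (H true).Nonempty) := by
    rintro ⟨⟨x, hx⟩, ⟨y, hy⟩⟩
    simp only [hH, Bool.false_eq_true, if_false, if_true] at hx hy
    have h1 := (abs_le.1 (hbd x hx.1).2).1; have h2 := (abs_le.1 (hbd y hy.1).2).2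
    have h3 : x.2 ≤ c₀.2 - R := hx.2; have h4 : c₀.2 + R ≤ y.2 := hy.2
    linarith
  by_cases hVne : ∃ i, (V i).Nonempty
  · by_cases hHne : ∃ j, (H j).Nonempty
    · obtain ⟨i₀, hi₀⟩ := hVne
      obtain ⟨j₀, hj₀⟩ := hHne
      exact isPreconnected_iUnion_union_iUnion hVpre hHpre hcorner hi₀ hj₀
    · -- only vertical pieces: a single one
      push Not at hHne
      have hH0 : (⋃ j, H j) = ∅ := by
        rw [iUnion_eq_empty]; exact hHne
      rw [hH0, union_empty]
      obtain ⟨i₀, hi₀⟩ := hVne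
      have hother : V (!i₀) = ∅ := by
        apply not_nonempty_iff_eq_empty.1
        intro h
        cases i₀
        · exact hoppV ⟨hi₀, h⟩
        · exact hoppV ⟨h, hi₀⟩
      have hU : (⋃ i, V i) = V i₀ := by
        apply Subset.antisymm
        · refine iUnion_subset fun i ↦ ?_
          by_cases hi : i = i₀
          · rw [hi]
          · have : i = !i₀ := by cases i <;> cases i₀ <;> simp_all
            rw [this, hother]; exact empty_subset _
        · exact subset_iUnion V i₀
      rw [hU]; exact hVpre i₀
  · push Not at hVne
    have hV0 : (⋃ i, V i) = ∅ := by
      rw [iUnion_eq_empty]; exact hVne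
    rw [hV0, empty_union]
    by_cases hHne : ∃ j, (H j).Nonempty
    · obtain ⟨j₀, hj₀⟩ := hHne
      have hother : H (!j₀) = ∅ := by
        apply not_nonempty_iff_eq_empty.1
        intro h
        cases j₀
        · exact hoppH ⟨hj₀, h⟩
        · exact hoppH ⟨h, hj₀⟩
      have hU : (⋃ j, H j) = H j₀ := by
        apply Subset.antisymm
        · refine iUnion_subset fun j ↦ ?_
          by_cases hj : j = j₀
          · rw [hj]
          · have : j = !j₀ := by cases j <;> cases j₀ <;> simp_all
            rw [this, hother]; exact empty_subset _
        · exact subset_iUnion H j₀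
      rw [hU]; exact hHpre j₀
    · push Not at hHne
      have hH0 : (⋃ j, H j) = ∅ := by
        rw [iUnion_eq_empty]; exact hHne
      rw [hH0]; exact isPreconnected_empty

/-! ## Contour lines as images of boundary arcs -/

section LevelLines

variable {m h : ℝ} {ψ : ℝ × ℝ → ℝ}

/-- **The contour line** of the cone at height `h`, inside the closed square. [folklore] -/
def levelLine (c : ℝ × ℝ) (ℓ m : ℝ) (ψ : ℝ × ℝ → ℝ) (h : ℝ) : Set (ℝ × ℝ) :=
  {x | x ∈ closedBall c ℓ ∧ coneHt c ℓ m ψ x = h}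

/-- Membership in the contour line. [folklore] -/
theorem mem_levelLine_iff {x : ℝ × ℝ} : x ∈ levelLine c ℓ m ψ h ↔ x ∈ closedBall c ℓ ∧ coneHt c ℓ m ψ x = h := Iff.rfl

/-- **Roof: the contour line is the `levelPt`-image of the boundary points of height `≤ h`.**
[folklore] -/
theorem levelLine_eq_image (hℓ : 0 < ℓ) (hm : ∀ q ∈ sphere c ℓ, ψ q < m) (hh : h < m) :
    levelLine c ℓ m ψ h = (fun q ↦ levelPt c m ψ q h) '' {q | q ∈ sphere c ℓ ∧ ψ q ≤ h} := by
  ext x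
  rw [mem_levelLine_iff, mem_image]
  constructor
  · rintro ⟨hx, hxh⟩
    obtain ⟨q, hq, hψq, rfl⟩ := (coneHt_eq_iff hℓ hm hh hx).1 hxh
    exact ⟨q, ⟨hq, hψq⟩, rfl⟩
  · rintro ⟨q, ⟨hq, hψq⟩, rfl⟩
    exact ⟨(levelPt_mem_closedBall_iff hℓ hq (hm q hq) hh.le).2 hψq, coneHt_levelPt hℓ hq (hm q hq) hh.le⟩

/-- **Floor: the contour line is the `levelPt`-image of the boundary points of height `≥ h`.**
[folklore] -/
theorem levelLine_eq_image_floor (hℓ : 0 < ℓ) (hm : ∀ q ∈ sphere c ℓ, m < ψ q) (hh : m < h) :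
    levelLine c ℓ m ψ h = (fun q ↦ levelPt c m ψ q h) '' {q | q ∈ sphere c ℓ ∧ h ≤ ψ q} := by
  ext x
  rw [mem_levelLine_iff, mem_image]
  constructor
  · rintro ⟨hx, hxh⟩
    obtain ⟨q, hq, hψq, rfl⟩ := (coneHt_eq_iff_floor hℓ hm hh hx).1 hxh
    exact ⟨q, ⟨hq, hψq⟩, rfl⟩
  · rintro ⟨q, ⟨hq, hψq⟩, rfl⟩
    exact ⟨(levelPt_mem_closedBall_iff_floor hℓ hq (hm q hq) hh.le).2 hψq, coneHt_levelPt_floor hℓ hq (hm q hq) hh.le⟩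

/-- `levelPt (·, h)` is continuous on the boundary square (roof). [folklore] -/
theorem continuousOn_levelPt_sphere (hm : ∀ q ∈ sphere c ℓ, ψ q < m) (hψ : ContinuousOn ψ (sphere c ℓ)) :
    ContinuousOn (fun q ↦ levelPt c m ψ q h) (sphere c ℓ) :=
  (continuousOn_levelPt hm hψ).comp (continuousOn_id.prodMk continuousOn_const) fun _ hq ↦ ⟨hq, mem_univ _⟩

/-- `levelPt (·, h)` is continuous on the boundary square (floor). [folklore] -/
theorem continuousOn_levelPt_sphere_floor (hm : ∀ q ∈ sphere c ℓ, m < ψ q) (hψ : ContinuousOn ψ (sphere c ℓ)) :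
    ContinuousOn (fun q ↦ levelPt c m ψ q h) (sphere c ℓ) := by
  have h1 : ContinuousOn (fun q ↦ levelPt c (-m) (fun y ↦ -ψ y) q (-h)) (sphere c ℓ) :=
    continuousOn_levelPt_sphere (fun q hq ↦ by linarith [hm q hq]) hψ.neg
  refine h1.congr fun q _ ↦ ?_
  exact (levelPt_neg c m ψ q h).symm

/-- **The contour line is compact and preconnected when the sub-level boundary arc is**
(roof). [folklore] -/
theorem isPreconnected_levelLine (hℓ : 0 < ℓ) (hm : ∀ q ∈ sphere c ℓ, ψ q < m) (hh : h < m)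
    (hψ : ContinuousOn ψ (sphere c ℓ)) (harc : IsPreconnected {q | q ∈ sphere c ℓ ∧ ψ q ≤ h}) :
    IsPreconnected (levelLine c ℓ m ψ h) := by
  rw [levelLine_eq_image hℓ hm hh]
  exact harc.image _ ((continuousOn_levelPt_sphere hm hψ).mono fun q hq ↦ hq.1)

/-- Compactness of the contour line (roof). [folklore] -/
theorem isCompact_levelLine (hℓ : 0 < ℓ) (hm : ∀ q ∈ sphere c ℓ, ψ q < m) (hh : h < m)
    (hψ : ContinuousOn ψ (sphere c ℓ)) : IsCompact (levelLine c ℓ m ψ h) := by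
  rw [levelLine_eq_image hℓ hm hh]
  have hcl : IsClosed {q | q ∈ sphere c ℓ ∧ ψ q ≤ h} := by
    show IsClosed (sphere c ℓ ∩ ψ ⁻¹' Iic h)
    exact hψ.preimage_isClosed_of_isClosed isClosed_sphere isClosed_Iic
  exact ((isCompact_sphere c ℓ).of_isClosed_subset hcl fun q hq ↦ hq.1).image_of_continuousOn
    ((continuousOn_levelPt_sphere hm hψ).mono fun q hq ↦ hq.1)

/-- Preconnectedness of the contour line (floor). [folklore] -/
theorem isPreconnected_levelLine_floor (hℓ : 0 < ℓ) (hm : ∀ q ∈ sphere c ℓ, m < ψ q) (hh : m < h)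
    (hψ : ContinuousOn ψ (sphere c ℓ)) (harc : IsPreconnected {q | q ∈ sphere c ℓ ∧ h ≤ ψ q}) :
    IsPreconnected (levelLine c ℓ m ψ h) := by
  rw [levelLine_eq_image_floor hℓ hm hh]
  exact harc.image _ ((continuousOn_levelPt_sphere_floor hm hψ).mono fun q hq ↦ hq.1)

/-- Compactness of the contour line (floor). [folklore] -/
theorem isCompact_levelLine_floor (hℓ : 0 < ℓ) (hm : ∀ q ∈ sphere c ℓ, m < ψ q) (hh : m < h)
    (hψ : ContinuousOn ψ (sphere c ℓ)) : IsCompact (levelLine c ℓ m ψ h) := by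
  rw [levelLine_eq_image_floor hℓ hm hh]
  have hcl : IsClosed {q | q ∈ sphere c ℓ ∧ h ≤ ψ q} := by
    show IsClosed (sphere c ℓ ∩ ψ ⁻¹' Ici h)
    exact hψ.preimage_isClosed_of_isClosed isClosed_sphere isClosed_Ici
  exact ((isCompact_sphere c ℓ).of_isClosed_subset hcl fun q hq ↦ hq.1).image_of_continuousOn
    ((continuousOn_levelPt_sphere_floor hm hψ).mono fun q hq ↦ hq.1)

/-- **The contour line meets the boundary square exactly in the boundary points of height `h`.**
[folklore] -/
theorem levelLine_inter_sphere (hℓ : 0 < ℓ) : levelLine c ℓ m ψ h ∩ sphere c ℓ = {q | q ∈ sphere c ℓ ∧ ψ q = h} := by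
  ext x
  constructor
  · rintro ⟨hx, hxs⟩
    exact ⟨hxs, by rw [← hx.2]; exact (coneHt_of_mem_sphere hℓ hxs).symm⟩
  · rintro ⟨hxs, hψx⟩
    exact ⟨⟨sphere_subset_closedBall hxs, by rw [coneHt_of_mem_sphere hℓ hxs, hψx]⟩, hxs⟩

end LevelLines

/-! ## Radial boundary heights -/

section Radial

variable {m : ℝ} {ψ : ℝ × ℝ → ℝ} {Ψ : ℝ → ℝ} {K : Set ℝ} {R : ℝ}

/-- **Radial boundary heights**: on the boundary square the heights are a strictly monotone
function of the distance to `c₀`. [folklore] -/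
structure IsRadial (c₀ c : ℝ × ℝ) (ℓ : ℝ) (ψ : ℝ × ℝ → ℝ) (Ψ : ℝ → ℝ) (K : Set ℝ) : Prop where
  eq : ∀ x ∈ sphere c ℓ, ψ x = Ψ (dist x c₀)
  mem : ∀ x ∈ sphere c ℓ, dist x c₀ ∈ K
  mono : StrictMonoOn Ψ K ∨ StrictAntiOn Ψ K

/-- The sub-level boundary arc of a radial height function is a big-square piece of the boundary
square (increasing case) or the complement piece (decreasing case); in either case it is
preconnected, and so is the super-level arc. [folklore] -/
theorem IsRadial.isPreconnected_arcs (hrad : IsRadial c₀ c ℓ ψ Ψ K) (hℓ : 0 < ℓ) (hR : R ∈ K) (hℓR : ℓ < R) :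
    IsPreconnected {q | q ∈ sphere c ℓ ∧ ψ q ≤ Ψ R} ∧ IsPreconnected {q | q ∈ sphere c ℓ ∧ Ψ R ≤ ψ q} := by
  have hin : {q | q ∈ sphere c ℓ ∧ dist q c₀ ≤ R} = sphere c ℓ ∩ closedBall c₀ R := by
    ext q; simp [mem_closedBall]
  have hout : {q | q ∈ sphere c ℓ ∧ R ≤ dist q c₀} = sphere c ℓ ∩ (ball c₀ R)ᶜ := by
    ext q; simp [mem_ball, not_lt]
  rcases hrad.mono with hmono | hanti
  · have h1 : {q | q ∈ sphere c ℓ ∧ ψ q ≤ Ψ R} = {q | q ∈ sphere c ℓ ∧ dist q c₀ ≤ R} := by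
      ext q; constructor
      · rintro ⟨hq, h⟩; exact ⟨hq, (hmono.le_iff_le (hrad.mem q hq) hR).1 (by rw [← hrad.eq q hq]; exact h)⟩
      · rintro ⟨hq, h⟩; exact ⟨hq, by rw [hrad.eq q hq]; exact (hmono.le_iff_le (hrad.mem q hq) hR).2 h⟩
    have h2 : {q | q ∈ sphere c ℓ ∧ Ψ R ≤ ψ q} = {q | q ∈ sphere c ℓ ∧ R ≤ dist q c₀} := by
      ext q; constructor
      · rintro ⟨hq, h⟩; exact ⟨hq, (hmono.le_iff_le hR (hrad.mem q hq)).1 (by rw [← hrad.eq q hq]; exact h)⟩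
      · rintro ⟨hq, h⟩; exact ⟨hq, by rw [hrad.eq q hq]; exact (hmono.le_iff_le hR (hrad.mem q hq)).2 h⟩
    rw [h1, h2, hin, hout]
    exact ⟨isPreconnected_sphere_inter_closedBall hℓ hℓR, isPreconnected_sphere_diff_ball hℓ hℓR⟩
  · have h1 : {q | q ∈ sphere c ℓ ∧ ψ q ≤ Ψ R} = {q | q ∈ sphere c ℓ ∧ R ≤ dist q c₀} := by
      ext q; constructor
      · rintro ⟨hq, h⟩; exact ⟨hq, (StrictAntiOn.le_iff_ge hanti (hrad.mem q hq) hR).1 (by rw [← hrad.eq q hq]; exact h)⟩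
      · rintro ⟨hq, h⟩; exact ⟨hq, by rw [hrad.eq q hq]; exact (StrictAntiOn.le_iff_ge hanti (hrad.mem q hq) hR).2 h⟩
    have h2 : {q | q ∈ sphere c ℓ ∧ Ψ R ≤ ψ q} = {q | q ∈ sphere c ℓ ∧ dist q c₀ ≤ R} := by
      ext q; constructor
      · rintro ⟨hq, h⟩; exact ⟨hq, (StrictAntiOn.le_iff_ge hanti hR (hrad.mem q hq)).1 (by rw [← hrad.eq q hq]; exact h)⟩
      · rintro ⟨hq, h⟩; exact ⟨hq, by rw [hrad.eq q hq]; exact (StrictAntiOn.le_iff_ge hanti hR (hrad.mem q hq)).2 h⟩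
    rw [h1, h2, hin, hout]
    exact ⟨isPreconnected_sphere_diff_ball hℓ hℓR, isPreconnected_sphere_inter_closedBall hℓ hℓR⟩

/-- **The contour line of a radial roof square at the height of the radius `R` is a connected
compact set.** [folklore] -/
theorem IsRadial.isPreconnected_levelLine (hrad : IsRadial c₀ c ℓ ψ Ψ K) (hℓ : 0 < ℓ) (hR : R ∈ K) (hℓR : ℓ < R)
    (hm : ∀ q ∈ sphere c ℓ, ψ q < m) (hh : Ψ R < m) (hψ : ContinuousOn ψ (sphere c ℓ)) :
    IsPreconnected (levelLine c ℓ m ψ (Ψ R)) :=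
  ConeSquare.isPreconnected_levelLine hℓ hm hh hψ (hrad.isPreconnected_arcs hℓ hR hℓR).1

/-- The same for a radial floor square. [folklore] -/
theorem IsRadial.isPreconnected_levelLine_floor (hrad : IsRadial c₀ c ℓ ψ Ψ K) (hℓ : 0 < ℓ) (hR : R ∈ K) (hℓR : ℓ < R)
    (hm : ∀ q ∈ sphere c ℓ, m < ψ q) (hh : m < Ψ R) (hψ : ContinuousOn ψ (sphere c ℓ)) :
    IsPreconnected (levelLine c ℓ m ψ (Ψ R)) :=
  ConeSquare.isPreconnected_levelLine_floor hℓ hm hh hψ (hrad.isPreconnected_arcs hℓ hR hℓR).2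

/-- **The contour line of a radial square at the height of the radius `R` meets the boundary
square exactly at the boundary points at distance `R` from `c₀`.** [folklore] -/
theorem IsRadial.levelLine_inter_sphere (hrad : IsRadial c₀ c ℓ ψ Ψ K) (hℓ : 0 < ℓ) (hR : R ∈ K) :
    levelLine c ℓ m ψ (Ψ R) ∩ sphere c ℓ = sphere c ℓ ∩ sphere c₀ R := by
  rw [ConeSquare.levelLine_inter_sphere hℓ]
  ext q
  simp only [mem_setOf_eq, mem_inter_iff, mem_sphere]
  constructor
  · rintro ⟨hq, h⟩
    refine ⟨hq, ?_⟩
    have hinj : InjOn Ψ K := hrad.mono.elim StrictMonoOn.injOn StrictAntiOn.injOn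
    exact hinj (hrad.mem q hq) hR (by rw [← hrad.eq q hq]; exact h)
  · rintro ⟨hq, h⟩
    exact ⟨hq, by rw [hrad.eq q hq]; exact congrArg Ψ h⟩

end Radial

end ConeSquare

end Literature.Topology.FourManifolds
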